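import Summits.QuantumFields.BalabanUV.T4Continuum.Spine.NE1p.DressedSmallFieldShape
import Summits.QuantumFields.BalabanUV.T4Continuum.Spine.NE1p.DressedSmallFieldPencilWitness
import Summits.QuantumFields.BalabanUV.T4Continuum.Support.NE9TiltedProduct

/-!
# T⁴ programme, spine estimate NE1′ (node O3b/H2) — WITNESS ROW «THE GAUSSIAN ABSORBS (2.20)»: N0k's ω-DEPENDENT functional
# bound `hl : ‖ℓ_ω‖ ≤ l(ω)` and its integrability socket `hint : Integrable (‖pre(ω)‖·e^{l(ω)R₀}) ν` INHABITED on a DIFFUSE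
# fluctuation measure — one Gaussian variable, a functional QUADRATIC in the field, contour radius = table size / α₄ with α₄ < 1

Cell `pub-balaban`, sub-cell `t4`, BINDER-OWNERS row NE1′ (owner lineage t4-ne1p-p1); NE1′ formalisation crew, unit `b2b-balaban-t4-ne1p-formalise-leaf-10`
(LEAF PROVER 10), generation 7; crew witness row of `t4/formal/NE1p/LEAVES.md` (the typer labels it).  ADDITIVE — imports N0k
`Spine/NE1p/DressedSmallFieldShape` (owner g26, p220184), W23 `Spine/NE1p/DressedSmallFieldPencilWitness` (crew leaf-08 g6, p221160; one-cube datum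
`cubes₁`∕`d₁`∕`hloc₁`∕`h126₁`∕`hvol₁`∕`h227₁`∕ `hsmall₁`∕`Z₁_eq` BY NAME) and `Support/NE9TiltedProduct` (lineage t4-ne9-p1 g19;
`withDensity_quadLinTilt_gaussianReal`∕`tiltConst` BY NAME — the NE9 row's kernel of [Balaban1988RGII] (2.23)–(2.24)) ONLY.  Toy DATA defs
`linG`∕`lG`∕`pG`∕`actG` + theorems; 0 `def … : Prop`; nothing of N0k ∕ W23 ∕ NE9 restated.
v1.1 (DOC-ONLY, X112 reader leaf-06-g7's DOCFIX-LOW candidate adopted): the `hint_gaussian` ∕ `not_hint_of_one_le` docstrings now say «the toy's room `τR₀ < 1`, which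
MODELS print's α₄ of (2.18)» (owner g27's wording wish, typer R-T99 (iv)(h)); every v1 declaration byte-identical in statement and proof.

WHY THIS FILE.  N0k types ONE term of the (2.14)-shape of [Balaban1988RGII] p. 15 as `Q ↦ ∫ pre(ω)·exp(ℓ_ω Q) dν(ω)` with an ω-DEPENDENT operator-norm bound
`‖ℓ_ω‖ ≤ l(ω)` and the socket `‖pre(ω)‖·e^{l(ω)R₀} ∈ L¹(ν)` (its header: «here with an ω-DEPENDENT functional bound to be faithful to (2.20)» — p. 16 «… ≤
½O(1)α₄ Σ_{b⊂Y₀}|B(b)|² + O(1)α₄M⁻⁴|Y₀|. (2.20)», QUADRATIC in the fluctuation field, «absorbed into the Gaussian measure ((2.21)–(2.26))»).  Every inhabitant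
of these sockets in the tree so far is ATOMIC with a CONSTANT bound — N0k §5 and N0l §3 (`Measure.dirac ()`, `l := fun _ => 1`, `integrable_const`), node U3's
`T4HistoryLipschitzActivity` §7∕§8e (constant `l`); W23∕W24∕W25 carry scalar activities with no (2.14)-shape.  Here:
* ν := Mathlib's `gaussianReal 0 1` — ONE fluctuation variable `B ~ 𝒩(0,1)` (dμ_C(B) at one bond, unit covariance; TYPE);
* `Pot := ℂ × ℂ` — a table entry = (quadratic-form coefficient, field-independent part): p. 11 (1.42) «𝐕_k(Y,B) = ½⟨Q(Y,B),B,B⟩ + 𝐕″_k(Y,B)» (TYPE);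
  functional `linG τ B := τ•((B²∕2)•fst + snd)` — evaluate the table at the field, times the contour parameter τ(Y) (the exponent «exp[Σ_{Y∈𝐃} τ(Y)𝐕_k(Y,B)]»
  of (2.14), TYPE) — of operator norm `≤ lG τ B := τ·(B²∕2 + 1)`, the shape of (2.19)∕(2.20), UNBOUNDED in ω (`linG_unbounded`: N0k's ω-dependence is
  NECESSARY for this term);
* `hint` DISCHARGED BY THE GAUSSIAN: `∫ ‖p‖·e^{τR₀(B²∕2+1)} d𝒩(0,1) = ‖p‖·e^{τR₀}·(1 − τR₀)^{−1∕2}` (`majorant_eq`) as soon as `τ·R₀ < 1` — contour radius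
  `1∕τ` = table radius `R₀` over a room `α₄ := τR₀ < 1`, which MODELS (a reading, not an identification) print's «small, positive number α₄» of p. 16 (2.18)
  «1∕|τ(Y)| = E₀ε₁C₁α₄⁻¹M^q exp C₂κ₁ exp(−(1 − 3δ)κd_k(Y))» (TYPE) — and NOT integrable at `1 ≤ τR₀` (`not_hint_of_one_le`): the smallness is LOAD-BEARING in
  kernel.  SCOPE (typer R-T99 (iv)(h)): ν is ONE real standard Gaussian — a one-bond toy of print's lattice Gaussian dμ_{C^{(k)}}(B); the (2.21)–(2.26)
  «absorption» exercised here is completing the square in ONE variable; the threshold `τ·R₀ < 1` is the TOY's; «U3's constant-`l` model cannot host the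
  quadratic term» is a statement about OUR modules (U3 §7∕§8e, N0k's header), not about print.

WHAT IS PROVED ([folklore] kernel — elementary Gaussian measure theory + by-name composition; no estimate on Bałaban's functions): §0 `∫ e^{(β∕2)x²} d𝒩(0,1) =
(1 − β)^{−1∕2}` for `β < 1` (NE9's identity at `γ = 0` evaluated on `univ`) and `¬ Integrable` for `1 ≤ β`; §1 the datum and N0k's sockets `hl`∕`hlinw`∕`hint`
(`norm_linG_le`, `aestronglyMeasurable_linG_apply`, `hint_gaussian`), the closed-form (2.15)-majorant `majorant_eq`, the certificates
`linG_unbounded`∕`not_hint_of_one_le`; §2 N0k §1 FIRES BY NAME ONCE EACH along the linearly dressed table `s ↦ V₀ + s•O` (radius `ε₁ + μ₁b₀`, N0k §3 BY NAME):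
`term_differentiableOn`, `term_norm_le`; §3 N0k §4's END `muPart_locE_le_of_linearDressing` FIRES (ONE application BY NAME) on W23's one-cube datum with the
Gaussian (2.14)-shape `actG` at the located prefactor `pG α₄ := e^{−α₄}(1−α₄)^{1∕2}∕3` (`hL3` with `A = 1∕3` TIGHT — toy-true BY CHOICE, NOT (2.38)):
`muPart_firesG(')`; §4 GENUINE — the term is a LIVE Gaussian integral with the real closed form `actG_ofReal`, it MOVES with the source (`actG_live`) and so
does the dressed output (`locE_live_G`, via B13's `exp_sum_locE_eq_Z` + W23 `Z₁_eq` BY NAME): §3 bounds a NON-ZERO quantity.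

WHAT THIS IS NOT.  The identification of `linG`∕`gaussianReal 0 1`∕`ℂ × ℂ` with Bałaban's τ(Y)𝐕_k(Y,B) ∕ dμ_{C^{(k)}}(B) ∕ (1.42) is the owner's READING (memo
`OWNER-ANSWERS-g26.md` (R3)) EXERCISED ON A TOY; nothing of (2.14)'s data, of (B1) `hrep` for Bałaban's densities, of (B3) `hL3` (toy-true by choice; = GAPS
G-ne9p2-5 UNPRINTED, shared with row NE9) or of (B5) against print's numbers is instantiated; `α₄ < 1` is the kernel threshold OF THIS TOY — no numeral
asserted from print («α₄ small» is print's displayed TYPE); no wall item is discharged; R-t4r2-Q2 NOT met thereby.  NE1′ ⇐ the named binders — NOT proved, NOT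
printed; spine PROVED 0∕9; count 9 unchanged.  HONEST FRAMING: rung (B)+1 on ONE finite four-torus — NOT infinite volume, NOT a mass gap, NOT OS on ℝ⁴, NOT
Clay.  ABSOLUTE RULE honoured: the quotations are LOCI of the audited manuscript [Balaban1988RGII] (CMP 116 (1988) 1–22, pp. 11, 15, 16; (S11)–(S14) graded
VERBATIM by t4-ref2 pass 76, C-t4r2-354), TYPE∕CONTEXT only, never hypothesis-free facts; nothing internally minted is cited; [folklore] tags on kernel lemmas
only.  HONEST DEPENDENCY: continuum YM on T⁴ ⇐ BetaPertH ∧ nine spine estimates (0/9 proved); BetaPertH ⇐ (D1) ∧ (D4) ∧ CAP+tail; G-an2-4 gates asym, D1 and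
NE2/3/4.
-/

noncomputable section

namespace Summit.QuantumFields.BalabanUV.T4Continuum.NE1p.DressedSmallFieldShapeWitness

open MeasureTheory ProbabilityTheory Metric Set Complex Finset
open scoped NNReal ENNReal
open Summit.QuantumFields.BalabanUV.T4Continuum.NE1p.DressedSmallFieldShape (differentiableOn_term_comp norm_term_comp_le
  mapsTo_dressedTable_smul differentiable_dressedTable_smul muPart_locE_le_of_linearDressing)
open Summit.QuantumFields.BalabanUV.T4Continuum.NE1p.DressedSmallFieldPencilWitness (cubes₁ d₁ hloc₁ h126₁ hvol₁ h227₁ hsmall₁ Z₁_eq)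
open Summit.QuantumFields.BalabanUV.T4Continuum.NE9TiltedProduct (tiltConst withDensity_quadLinTilt_gaussianReal)
open Literature.MathematicalPhysics.QuantumFieldTheory.Balaban1983to89.B13Resummation (locE locE_congr exp_sum_locE_eq_Z)
open Literature.Probability.LatticeModels (polymerPartitionFunction)

/-! ## §0 THE GAUSSIAN ENGINE: `∫ e^{(β/2)x²} d𝒩(0,1)(x) = (1 − β)^{−1/2}` iff `β < 1` -/

/-- NE9's tilt normalisation at zero linear term is `(1 − β)^{−1/2}`. [folklore] -/
theorem tiltConst_zero (β : ℝ) : tiltConst β 0 = (Real.sqrt (1 - β))⁻¹ := by simp [tiltConst]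

/-- **THE GAUSSIAN ABSORBS A QUADRATIC FORM OF SIZE `β < 1`** (lintegral form): `∫⁻ e^{(β/2)x²} d𝒩(0,1) = (1 − β)^{−1/2}` — ONE application of the NE9
lineage's completing-the-square identity `NE9TiltedProduct.withDensity_quadLinTilt_gaussianReal` (at `γ = 0`), evaluated on `univ`. [folklore] -/
theorem lintegral_exp_quad_gaussianReal {β : ℝ} (hβ : β < 1) :
    ∫⁻ x, ENNReal.ofReal (Real.exp (β / 2 * x ^ 2)) ∂(gaussianReal 0 1) = ENNReal.ofReal ((Real.sqrt (1 - β))⁻¹) := by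
  have hu := congrArg (fun m : Measure ℝ => m Set.univ) (withDensity_quadLinTilt_gaussianReal hβ 0)
  simp only [withDensity_apply _ MeasurableSet.univ, Measure.restrict_univ, zero_mul, add_zero,
    Measure.smul_apply, measure_univ, ENNReal.smul_def, smul_eq_mul, mul_one] at hu
  rw [hu, tiltConst_zero]; rfl

/-- `e^{(β/2)x²} ∈ L¹(𝒩(0,1))` for `β < 1`. [folklore] -/
theorem integrable_exp_quad_gaussianReal {β : ℝ} (hβ : β < 1) :
    Integrable (fun x : ℝ => Real.exp (β / 2 * x ^ 2)) (gaussianReal 0 1) := by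
  have hmeas : AEMeasurable (fun x : ℝ => ENNReal.ofReal (Real.exp (β / 2 * x ^ 2))) (gaussianReal 0 1) := by fun_prop
  have h := integrable_toReal_of_lintegral_ne_top hmeas (by rw [lintegral_exp_quad_gaussianReal hβ]; exact ENNReal.ofReal_ne_top)
  refine h.congr (Filter.Eventually.of_forall fun x => ?_)
  simp [ENNReal.toReal_ofReal (Real.exp_pos _).le]

/-- `∫ e^{(β/2)x²} d𝒩(0,1)(x) = (1 − β)^{−1/2}` for `β < 1` (Bochner form). [folklore] -/
theorem integral_exp_quad_gaussianReal {β : ℝ} (hβ : β < 1) :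
    ∫ x, Real.exp (β / 2 * x ^ 2) ∂(gaussianReal 0 1) = (Real.sqrt (1 - β))⁻¹ := by
  rw [integral_eq_lintegral_of_nonneg_ae (Filter.Eventually.of_forall fun x => (Real.exp_pos _).le)
    (by fun_prop : AEStronglyMeasurable (fun x : ℝ => Real.exp (β / 2 * x ^ 2)) (gaussianReal 0 1)),
    lintegral_exp_quad_gaussianReal hβ, ENNReal.toReal_ofReal]
  exact inv_nonneg.2 (Real.sqrt_nonneg _)

/-- **THE GAUSSIAN DOES NOT ABSORB A QUADRATIC FORM OF FULL SIZE**: for `1 ≤ β`, `e^{(β/2)x²} ∉ L¹(𝒩(0,1))` — against Lebesgue measure the density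
`(2π)^{−1/2}e^{((β−1)/2)x²}` is bounded BELOW by `(2π)^{−1/2}`. [folklore] -/
theorem not_integrable_exp_quad_gaussianReal {β : ℝ} (hβ : 1 ≤ β) :
    ¬ Integrable (fun x : ℝ => Real.exp (β / 2 * x ^ 2)) (gaussianReal 0 1) := by
  intro h
  rw [gaussianReal_of_var_ne_zero 0 one_ne_zero, integrable_withDensity_iff_integrable_smul' (measurable_gaussianPDF 0 1)
    (Filter.Eventually.of_forall fun _ => gaussianPDF_lt_top)] at h
  have hc : ∀ x : ℝ, (Real.sqrt (2 * Real.pi))⁻¹ ≤ ‖(gaussianPDF 0 1 x).toReal • Real.exp (β / 2 * x ^ 2)‖ := by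
    intro x
    rw [toReal_gaussianPDF, gaussianPDFReal_def, smul_eq_mul, Real.norm_of_nonneg (by positivity)]
    simp only [NNReal.coe_one, mul_one, sub_zero]
    rw [mul_assoc, ← Real.exp_add]
    have h2 : 1 ≤ Real.exp (-x ^ 2 / 2 + β / 2 * x ^ 2) := Real.one_le_exp (by nlinarith [sq_nonneg x])
    have h3 : 0 < (Real.sqrt (2 * Real.pi))⁻¹ := by positivity
    nlinarith
  have hconst : Integrable (fun _ : ℝ => (Real.sqrt (2 * Real.pi))⁻¹) (volume : Measure ℝ) :=
    h.mono aestronglyMeasurable_const (Filter.Eventually.of_forall fun x => by rw [Real.norm_of_nonneg (by positivity)]; exact hc x)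
  rw [integrable_const_iff] at hconst
  rcases hconst with h0 | hfin
  · exact (inv_pos.2 (Real.sqrt_pos.2 (by positivity))).ne' h0
  · exact Real.volume_univ ▸ (measure_lt_top (volume : Measure ℝ) Set.univ) |>.ne rfl

/-! ## §1 THE DATUM: one Gaussian fluctuation variable, a table = (quadratic-form coefficient, constant part), the functional «evaluate at the field ×
contour parameter», and N0k's sockets `hl` ∕ `hlinw` ∕ `hint` on it -/

/-- THE FUNCTIONAL `ℓ_B = τ·(½B²·q + v)` on the table space `ℂ × ℂ ∋ (q, v)`: evaluate the table (1.42) at the fluctuation field `B`, times the contour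
parameter `τ = τ(Y)` (the exponent of (2.14), TYPE). Toy DATA. -/
def linG (τ B : ℝ) : ℂ × ℂ →L[ℂ] ℂ :=
  (τ : ℂ) • ((((B ^ 2 / 2 : ℝ) : ℂ)) • ContinuousLinearMap.fst ℂ ℂ ℂ + ContinuousLinearMap.snd ℂ ℂ ℂ)

/-- THE ω-DEPENDENT BOUND `l(B) = τ·(B²/2 + 1)` — the shape of (2.19)∕(2.20): quadratic in the fluctuation field plus a constant. Toy DATA. -/
def lG (τ B : ℝ) : ℝ := τ * (B ^ 2 / 2 + 1)

/-- THE LOCATED PREFACTOR `p(α) = e^{−α}(1 − α)^{1/2}/3`, chosen so that the (2.15)-majorant of the term is EXACTLY `1/3` (§3). Toy DATA. -/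
def pG (α : ℝ) : ℝ := Real.exp (-α) * Real.sqrt (1 - α) / 3

/-- Pointwise formula of the functional. [folklore] -/
theorem linG_apply (τ B : ℝ) (Q : ℂ × ℂ) : linG τ B Q = (τ : ℂ) * (((B ^ 2 / 2 : ℝ) : ℂ) * Q.1 + Q.2) := by
  simp [linG, mul_add]

/-- **SOCKET `hl` — THE OPERATOR NORM IS QUADRATIC IN THE FLUCTUATION FIELD**: `‖ℓ_B‖ ≤ τ·(B²/2 + 1)` for `0 ≤ τ` (sup norm on `ℂ × ℂ`). [folklore] -/
theorem norm_linG_le {τ : ℝ} (hτ : 0 ≤ τ) (B : ℝ) : ‖linG τ B‖ ≤ lG τ B := by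
  refine ContinuousLinearMap.opNorm_le_bound _ (by unfold lG; positivity) fun Q => ?_
  have hB : 0 ≤ B ^ 2 / 2 := by positivity
  rw [linG_apply, norm_mul, Complex.norm_real, Real.norm_of_nonneg hτ, lG, mul_assoc]
  refine mul_le_mul_of_nonneg_left ?_ hτ
  calc ‖((B ^ 2 / 2 : ℝ) : ℂ) * Q.1 + Q.2‖ ≤ ‖((B ^ 2 / 2 : ℝ) : ℂ) * Q.1‖ + ‖Q.2‖ := norm_add_le _ _
    _ = B ^ 2 / 2 * ‖Q.1‖ + ‖Q.2‖ := by rw [norm_mul, Complex.norm_real, Real.norm_of_nonneg hB]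
    _ ≤ B ^ 2 / 2 * ‖Q‖ + ‖Q‖ := add_le_add (mul_le_mul_of_nonneg_left (norm_fst_le Q) hB) (norm_snd_le Q)
    _ = (B ^ 2 / 2 + 1) * ‖Q‖ := by ring

/-- The functional on the pure quadratic-form table `(1, 0)`: `‖ℓ_B(1,0)‖ = |τ|·B²/2`. [folklore] -/
theorem norm_linG_apply_one_zero (τ B : ℝ) : ‖linG τ B ((1 : ℂ), (0 : ℂ))‖ = |τ| * (B ^ 2 / 2) := by
  rw [linG_apply, mul_one, add_zero, norm_mul, Complex.norm_real, Complex.norm_real, Real.norm_eq_abs, Real.norm_of_nonneg (by positivity)]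

/-- **GENUINE — N0k's ω-DEPENDENCE OF `hl` IS NECESSARY HERE**: for `τ ≠ 0` NO constant bounds the operator norms `‖ℓ_B‖`, `B ∈ ℝ` (node U3 §7's constant-`l`
model cannot host this term). [folklore] -/
theorem linG_unbounded {τ : ℝ} (hτ : τ ≠ 0) : ¬ ∃ l₀ : ℝ, ∀ B : ℝ, ‖linG τ B‖ ≤ l₀ := by
  rintro ⟨l₀, hl₀⟩
  have h1 : ‖((1 : ℂ), (0 : ℂ))‖ = 1 := by simp [Prod.norm_def]
  have key : ∀ B : ℝ, |τ| * (B ^ 2 / 2) ≤ l₀ := fun B => by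
    rw [← norm_linG_apply_one_zero]; exact ((linG τ B).le_opNorm _).trans (by rw [h1, mul_one]; exact hl₀ B)
  have hl0 : 0 ≤ l₀ := by simpa using key 0
  have hτ' : 0 < |τ| := abs_pos.2 hτ
  have h2 := key (Real.sqrt (2 * (l₀ + 1) / |τ|))
  rw [Real.sq_sqrt (by positivity : (0 : ℝ) ≤ 2 * (l₀ + 1) / |τ|)] at h2
  have h3 : |τ| * (2 * (l₀ + 1) / |τ| / 2) = l₀ + 1 := by field_simp
  linarith

/-- **SOCKET `hlinw`** — scalar measurability: `B ↦ ℓ_B(Q)` is continuous, hence a.e.-strongly measurable, for every table `Q`. [folklore] -/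
theorem aestronglyMeasurable_linG_apply (τ : ℝ) (ν : Measure ℝ) (Q : ℂ × ℂ) :
    AEStronglyMeasurable (fun B => linG τ B Q) ν := by
  have hc : Continuous fun B : ℝ => (τ : ℂ) * (((B ^ 2 / 2 : ℝ) : ℂ) * Q.1 + Q.2) := by fun_prop
  exact (hc.congr fun B => (linG_apply τ B Q).symm).aestronglyMeasurable

/-- The integrand of the majorant factorises: `e^{l(B)R₀} = e^{τR₀}·e^{(τR₀/2)B²}`. [folklore] -/
theorem exp_lG_mul (τ B R₀ : ℝ) : Real.exp (lG τ B * R₀) = Real.exp (τ * R₀) * Real.exp (τ * R₀ / 2 * B ^ 2) := by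
  rw [← Real.exp_add]; congr 1; unfold lG; ring

/-- **SOCKET `hint` — THE GAUSSIAN ABSORBS (2.20)**: `‖p‖·e^{l(B)R₀} ∈ L¹(𝒩(0,1))` as soon as `τ·R₀ < 1` (the contour radius `1/τ` exceeds the table radius
`R₀`: the toy's room `τR₀ < 1`, which MODELS print's «small, positive number α₄» of (2.18) (TYPE; a reading, not an identification)). [folklore] -/
theorem hint_gaussian (p : ℂ) {τ R₀ : ℝ} (h : τ * R₀ < 1) :
    Integrable (fun B : ℝ => ‖p‖ * Real.exp (lG τ B * R₀)) (gaussianReal 0 1) := by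
  refine ((integrable_exp_quad_gaussianReal h).const_mul (‖p‖ * Real.exp (τ * R₀))).congr (Filter.Eventually.of_forall fun B => ?_)
  simp only [exp_lG_mul]; ring

/-- **THE (2.15)-MAJORANT IN CLOSED FORM**: `∫ ‖p‖·e^{l(B)R₀} d𝒩(0,1)(B) = ‖p‖·e^{τR₀}·(1 − τR₀)^{−1/2}` for `τR₀ < 1`. [folklore] -/
theorem majorant_eq (p : ℂ) {τ R₀ : ℝ} (h : τ * R₀ < 1) :
    ∫ B, ‖p‖ * Real.exp (lG τ B * R₀) ∂(gaussianReal 0 1) = ‖p‖ * Real.exp (τ * R₀) * (Real.sqrt (1 - τ * R₀))⁻¹ := by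
  simp_rw [exp_lG_mul, ← mul_assoc]; rw [integral_const_mul, integral_exp_quad_gaussianReal h]

/-- **GENUINE — THE TOY'S ROOM `τR₀ < 1` (MODELLING print's α₄) IS LOAD-BEARING**: at `1 ≤ τ·R₀` (contour radius NOT larger than the table radius) the socket `hint` FAILS for every
non-zero prefactor. [folklore] -/
theorem not_hint_of_one_le {p : ℂ} (hp : p ≠ 0) {τ R₀ : ℝ} (h : 1 ≤ τ * R₀) :
    ¬ Integrable (fun B : ℝ => ‖p‖ * Real.exp (lG τ B * R₀)) (gaussianReal 0 1) := by
  intro hi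
  have hc : ‖p‖ * Real.exp (τ * R₀) ≠ 0 := mul_ne_zero (norm_ne_zero_iff.2 hp) (Real.exp_pos _).ne'
  refine not_integrable_exp_quad_gaussianReal h
    ((hi.const_mul (‖p‖ * Real.exp (τ * R₀))⁻¹).congr (Filter.Eventually.of_forall fun B => ?_))
  simp only [exp_lG_mul]; field_simp

/-! ## §2 N0k §1 FIRES: the Gaussian term along the linearly dressed table `s ↦ V₀ + s•O` -/

/-- THE TOY DRESSED ACTIVITY on W23's one-cube datum: ONE Gaussian term per polymer, `act s () = ∫ p·exp(ℓ_B(V₀ + s•O)) d𝒩(0,1)(B)` — the (2.14)-shape with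
μ-free data `(𝒩(0,1), p, ℓ)` read along the linearly dressed table. Toy DATA. -/
def actG (p : ℂ) (τ : ℝ) (V₀ O : ℂ × ℂ) (s : ℂ) (_Z : Unit) : ℂ :=
  ∫ B, p * cexp (linG τ B (V₀ + s • O)) ∂(gaussianReal 0 1)

section Term

variable (p : ℂ) {τ ε₁ b₀ μ₁ : ℝ} {V₀ O : ℂ × ℂ}

/-- **N0k §1 `differentiableOn_term_comp` FIRES** (ONE application BY NAME; `hl`∕`hlinw`∕`hint` = §1, `hV`∕`hVR` = N0k §3
`differentiable_dressedTable_smul`∕`mapsTo_dressedTable_smul` BY NAME): for an undressed table `‖V₀‖ ≤ ε₁`, an observable table `‖O‖ ≤ b₀`, `0 < b₀`, and a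
contour parameter with `τ·(ε₁ + μ₁b₀) < 1`, the Gaussian term is complex differentiable in the source on `‖s‖ < μ₁`. -/
theorem term_differentiableOn (hτ : 0 ≤ τ) (hV₀ : ‖V₀‖ ≤ ε₁) (hO : ‖O‖ ≤ b₀) (hb₀ : 0 < b₀) (hlt : τ * (ε₁ + μ₁ * b₀) < 1) :
    DifferentiableOn ℂ (fun s => actG p τ V₀ O s ()) (ball (0 : ℂ) μ₁) := by
  unfold actG
  exact differentiableOn_term_comp (ν := gaussianReal 0 1) (pre := fun _ => p) (lin := linG τ) (l := lG τ)
    (R₀ := ε₁ + μ₁ * b₀) (V := fun s => V₀ + s • O) aestronglyMeasurable_const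
    (aestronglyMeasurable_linG_apply τ _) (norm_linG_le hτ) (hint_gaussian p hlt) isOpen_ball
    (differentiable_dressedTable_smul V₀ O).differentiableOn (mapsTo_dressedTable_smul hV₀ hO hb₀)

/-- **N0k §1 `norm_term_comp_le` FIRES** (ONE application BY NAME + `majorant_eq`): on `‖s‖ < μ₁` the Gaussian term is bounded by the closed-form
(2.15)-majorant `‖p‖·e^{α₄}·(1 − α₄)^{−1/2}`, `α₄ = τ(ε₁ + μ₁b₀)`. -/
theorem term_norm_le (hτ : 0 ≤ τ) (hV₀ : ‖V₀‖ ≤ ε₁) (hO : ‖O‖ ≤ b₀) (hb₀ : 0 < b₀) (hlt : τ * (ε₁ + μ₁ * b₀) < 1) {s : ℂ}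
    (hs : s ∈ ball (0 : ℂ) μ₁) : ‖actG p τ V₀ O s ()‖ ≤ ‖p‖ * Real.exp (τ * (ε₁ + μ₁ * b₀)) * (Real.sqrt (1 - τ * (ε₁ + μ₁ * b₀)))⁻¹ := by
  have h := norm_term_comp_le (ν := gaussianReal 0 1) (pre := fun _ => p) (lin := linG τ) (l := lG τ) (R₀ := ε₁ + μ₁ * b₀)
    (V := fun s => V₀ + s • O) (D := ball (0 : ℂ) μ₁) (norm_linG_le hτ) (hint_gaussian p hlt) (mapsTo_dressedTable_smul hV₀ hO hb₀) hs
  rwa [majorant_eq p hlt] at h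

end Term

/-! ## §3 N0k §4's END FIRES on W23's one-cube datum with the Gaussian (2.14)-shape -/

/-- The located prefactor is the nonnegative real `e^{−α}(1−α)^{1/2}/3`. [folklore] -/
theorem norm_pG {α : ℝ} : ‖((pG α : ℝ) : ℂ)‖ = pG α := by
  rw [Complex.norm_real, Real.norm_of_nonneg]; unfold pG; positivity

/-- The located prefactor makes the (2.15)-majorant EXACTLY `1/3`: `p(α)·e^{α}·(1 − α)^{−1/2} = 1/3` for `α < 1`. [folklore] -/
theorem pG_majorant {α : ℝ} (hα : α < 1) : pG α * Real.exp α * (Real.sqrt (1 - α))⁻¹ = 1 / 3 := by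
  have hs : Real.sqrt (1 - α) ≠ 0 := (Real.sqrt_pos.2 (by linarith)).ne'
  have he : Real.exp (-α) * Real.exp α = 1 := by rw [← Real.exp_add, neg_add_cancel, Real.exp_zero]
  have h3 : pG α * Real.exp α * (Real.sqrt (1 - α))⁻¹ =
      Real.exp (-α) * Real.exp α * (Real.sqrt (1 - α) * (Real.sqrt (1 - α))⁻¹) / 3 := by unfold pG; ring
  rw [h3, he, mul_inv_cancel₀ hs]; norm_num

section End

variable {ε₁ b₀ μ₁ μ₀ α : ℝ} {V₀ O : ℂ × ℂ} {μ : ℂ}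

/-- **SOCKET `hL3` AT `A = 1/3`, TIGHT** — toy-true BY CHOICE of the prefactor `pG α₄` (NOT (2.38) for any dressed activity): on every polymer of the one-cube
datum the (2.15)-majorant of the one Gaussian term at the dressed radius `ε₁ + μ₁b₀` equals `1/3 = (1/3)·e^{−2·0}`. -/
theorem hL3_G (hα : α < 1) (hR : 0 < ε₁ + μ₁ * b₀) :
    ∀ Z : Unit, cubes₁ Z ⊆ {()} →
      ∑ j ∈ ({()} : Finset Unit), ∫ B, ‖((pG α : ℝ) : ℂ)‖ * Real.exp (lG (α / (ε₁ + μ₁ * b₀)) B * (ε₁ + μ₁ * b₀))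
          ∂((fun _ : Unit => gaussianReal 0 1) j) ≤ 1 / 3 * Real.exp (-(2 * d₁ Z)) := by
  intro Z _
  have hτR : α / (ε₁ + μ₁ * b₀) * (ε₁ + μ₁ * b₀) = α := div_mul_cancel₀ α hR.ne'
  rw [sum_singleton, majorant_eq _ (by rw [hτR]; exact hα), hτR, norm_pG, pG_majorant hα]
  simp [d₁]

/-- **N0k §4 `muPart_locE_le_of_linearDressing` FIRES WITH A GAUSSIAN LETTER** (ONE application BY NAME; geometry sockets = W23's
`hloc₁`∕`h126₁`∕`hvol₁`∕`h227₁`∕`hsmall₁` BY NAME; `hrep` definitional; `hpre`∕`hlinw`∕`hl`∕`hint` = §1; `hL3` = `hL3_G`): for an undressed table `‖V₀‖ ≤ ε₁`,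
an observable table `‖O‖ ≤ b₀` (`0 < b₀`), a room `0 ≤ α₄ < 1` and the contour parameter `τ := α₄/(ε₁ + μ₁b₀)`, on `‖μ‖ ≤ μ₀ < μ₁`: `‖E_μ({()}) − E_0({()})‖ ≤
e·1·1·1²·(1/3)·e^{−0·0}·μ₀/(μ₁ − μ₀)`. -/
theorem muPart_firesG (hV₀ : ‖V₀‖ ≤ ε₁) (hO : ‖O‖ ≤ b₀) (hb₀ : 0 < b₀) (hα0 : 0 ≤ α) (hα1 : α < 1)
    (h0 : 0 < μ₀) (h01 : μ₀ < μ₁) (hμ : ‖μ‖ ≤ μ₀) :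
    ‖locE (@Eq Unit) cubes₁ (actG (pG α) (α / (ε₁ + μ₁ * b₀)) V₀ O μ) {()} -
        locE (@Eq Unit) cubes₁ (actG (pG α) (α / (ε₁ + μ₁ * b₀)) V₀ O 0) {()}‖ ≤
      Real.exp 1 * 1 * 1 * 1 ^ 2 * (1 / 3) * Real.exp (-(0 * 0)) * (μ₀ / (μ₁ - μ₀)) := by
  have hε₁ : 0 ≤ ε₁ := (norm_nonneg _).trans hV₀
  have hR : 0 < ε₁ + μ₁ * b₀ := by nlinarith
  have hτ : 0 ≤ α / (ε₁ + μ₁ * b₀) := div_nonneg hα0 hR.le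
  have hlt : α / (ε₁ + μ₁ * b₀) * (ε₁ + μ₁ * b₀) < 1 := by rw [div_mul_cancel₀ α hR.ne']; exact hα1
  exact muPart_locE_le_of_linearDressing (@Eq Unit) (reach := cubes₁) (d := d₁) (A := 1 / 3) (R := 2) (r₁ := 0)
    (κ₀ := 0) (K₀ := 1) (c₁ := 1) (c := 0) (b := 0) (ν := 1) (dX := 0) (ν' := fun _ : Unit => gaussianReal 0 1)
    (pre := fun _ _ => ((pG α : ℝ) : ℂ)) (lin := fun _ => linG (α / (ε₁ + μ₁ * b₀)))
    (l := fun _ => lG (α / (ε₁ + μ₁ * b₀))) (terms := fun _ => ({()} : Finset Unit))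
    hloc₁ (fun Z => by rw [one_mul]) (fun _ => le_rfl) (by norm_num) (by norm_num) (by norm_num) (by norm_num) le_rfl
    le_rfl le_rfl (by norm_num) h126₁ hvol₁ h227₁ (by norm_num) hsmall₁ (singleton_nonempty ())
    (fun s _ Z => by simp [actG]) (fun _ => aestronglyMeasurable_const)
    (fun _ Q => aestronglyMeasurable_linG_apply _ _ Q) (fun _ B => norm_linG_le hτ B) (fun _ => hint_gaussian _ hlt)
    hV₀ hO hb₀ (hL3_G hα1 hR) h0 h01 hμ

/-- The same in closed form: `‖E_μ({()}) − E_0({()})‖ ≤ (e/3)·μ₀/(μ₁ − μ₀)` — pencil factor visible, the Gaussian letter integrated out. -/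
theorem muPart_firesG' (hV₀ : ‖V₀‖ ≤ ε₁) (hO : ‖O‖ ≤ b₀) (hb₀ : 0 < b₀) (hα0 : 0 ≤ α) (hα1 : α < 1)
    (h0 : 0 < μ₀) (h01 : μ₀ < μ₁) (hμ : ‖μ‖ ≤ μ₀) :
    ‖locE (@Eq Unit) cubes₁ (actG (pG α) (α / (ε₁ + μ₁ * b₀)) V₀ O μ) {()} -
        locE (@Eq Unit) cubes₁ (actG (pG α) (α / (ε₁ + μ₁ * b₀)) V₀ O 0) {()}‖ ≤ Real.exp 1 / 3 * (μ₀ / (μ₁ - μ₀)) := by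
  have h := muPart_firesG hV₀ hO hb₀ hα0 hα1 h0 h01 hμ
  simp only [mul_one, one_pow, mul_zero, neg_zero, Real.exp_zero] at h; simpa [div_eq_mul_inv] using h

end End

/-! ## §4 GENUINE: the Gaussian term in closed form for real data, and LIVENESS of the term and of the dressed output -/

/-- **THE TERM IS A LIVE GAUSSIAN INTEGRAL** (closed form for real data `V₀ = (q₀, v₀)`, `O = (o₁, o₂)`, real prefactor `r` and a real source `s` with `τ(q₀ +
s·o₁) < 1`): `act s () = r·e^{τ(v₀ + s·o₂)}·(1 − τ(q₀ + s·o₁))^{−1/2}` — §0's engine under the complex integral (`integral_complex_ofReal`). [folklore] -/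
theorem actG_ofReal (r τ q₀ v₀ o₁ o₂ s : ℝ) (h : τ * (q₀ + s * o₁) < 1) :
    actG (r : ℂ) τ ((q₀ : ℂ), (v₀ : ℂ)) ((o₁ : ℂ), (o₂ : ℂ)) (s : ℂ) () =
      ((r * Real.exp (τ * (v₀ + s * o₂)) * (Real.sqrt (1 - τ * (q₀ + s * o₁)))⁻¹ : ℝ) : ℂ) := by
  have hpt : ∀ B : ℝ, (r : ℂ) * cexp (linG τ B (((q₀ : ℂ), (v₀ : ℂ)) + (s : ℂ) • ((o₁ : ℂ), (o₂ : ℂ)))) =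
      ((r * Real.exp (τ * (v₀ + s * o₂)) * Real.exp (τ * (q₀ + s * o₁) / 2 * B ^ 2) : ℝ) : ℂ) := by
    intro B
    rw [mul_assoc, ← Real.exp_add, Complex.ofReal_mul, Complex.ofReal_exp, linG_apply]
    congr 2
    simp only [Prod.smul_mk, Prod.mk_add_mk, smul_eq_mul]; push_cast; ring
  unfold actG; simp_rw [hpt]; rw [integral_complex_ofReal, integral_const_mul, integral_exp_quad_gaussianReal h]

/-- **GENUINE — THE TERM MOVES WITH THE SOURCE**: for a positive prefactor and contour parameter, a positive source `μ₀` and an observable table `(o₁, o₂) ≠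
0` with nonnegative entries (attached quadratic form and∕or attached constant part), `act μ₀ () ≠ act 0 ()`. [folklore] -/
theorem actG_live {r τ q₀ v₀ o₁ o₂ μ₀ : ℝ} (hr : 0 < r) (hτ : 0 < τ) (h0 : 0 < μ₀) (ho₁ : 0 ≤ o₁) (ho₂ : 0 ≤ o₂)
    (hO : 0 < o₁ + o₂) (h1 : τ * (q₀ + μ₀ * o₁) < 1) :
    actG (r : ℂ) τ ((q₀ : ℂ), (v₀ : ℂ)) ((o₁ : ℂ), (o₂ : ℂ)) (μ₀ : ℂ) () ≠
      actG (r : ℂ) τ ((q₀ : ℂ), (v₀ : ℂ)) ((o₁ : ℂ), (o₂ : ℂ)) 0 () := by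
  have hq : τ * q₀ ≤ τ * (q₀ + μ₀ * o₁) := by nlinarith [mul_nonneg h0.le ho₁]
  have h1' : τ * (q₀ + 0 * o₁) < 1 := by rw [zero_mul, add_zero]; linarith
  rw [← Complex.ofReal_zero, actG_ofReal _ _ _ _ _ _ _ h1, actG_ofReal _ _ _ _ _ _ _ h1', Ne, Complex.ofReal_inj]
  simp only [zero_mul, add_zero]
  apply ne_of_gt
  have hs0 : 0 < Real.sqrt (1 - τ * (q₀ + μ₀ * o₁)) := Real.sqrt_pos.2 (by linarith)
  have hs1 : 0 < Real.sqrt (1 - τ * q₀) := Real.sqrt_pos.2 (by linarith)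
  have ha : r * Real.exp (τ * v₀) ≤ r * Real.exp (τ * (v₀ + μ₀ * o₂)) :=
    mul_le_mul_of_nonneg_left (Real.exp_le_exp.2 (by nlinarith [mul_nonneg h0.le ho₂])) hr.le
  have hb : (Real.sqrt (1 - τ * q₀))⁻¹ ≤ (Real.sqrt (1 - τ * (q₀ + μ₀ * o₁)))⁻¹ :=
    inv_anti₀ hs0 (Real.sqrt_le_sqrt (by linarith))
  rcases lt_or_eq_of_le ho₁ with ho₁' | ho₁'
  · have hb' : (Real.sqrt (1 - τ * q₀))⁻¹ < (Real.sqrt (1 - τ * (q₀ + μ₀ * o₁)))⁻¹ :=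
      inv_strictAnti₀ hs0 (Real.sqrt_lt_sqrt (by linarith) (by nlinarith [mul_pos h0 ho₁']))
    exact mul_lt_mul' ha hb' (inv_nonneg.2 hs1.le) (by positivity)
  · have ho₂' : 0 < o₂ := by rw [← ho₁', zero_add] at hO; exact hO
    have ha' : r * Real.exp (τ * v₀) < r * Real.exp (τ * (v₀ + μ₀ * o₂)) :=
      mul_lt_mul_of_pos_left (Real.exp_lt_exp.2 (by nlinarith [mul_pos h0 ho₂'])) hr
    exact mul_lt_mul ha' hb (inv_pos.2 hs1) (by positivity)

/-- B13's (2.11)–(2.12) identity `exp_sum_locE_eq_Z` on W23's one-cube datum for ANY activity of size `≤ 1/3` (its sockets at `τ = 1`, `s = b = 0` discharged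
by W23's `hloc₁`∕`h126₁`∕`hvol₁`∕`hsmall₁` and `Z₁_eq` BY NAME): `exp(Σ_X E(X)) = 1 + w ()`. [folklore] (the pattern of W23's `exp_sum_locE₁`, freed from its
activity) -/
theorem exp_sum_locE_oneCube {w : Unit → ℂ} (hw : ‖w ()‖ ≤ 1 / 3) :
    Complex.exp (∑ X ∈ (univ : Finset Unit).powerset.image (fun C => C.biUnion cubes₁),
      locE (@Eq Unit) cubes₁ w X) = 1 + w () := by
  have hw' : ∀ Z : Unit, ‖w Z‖ ≤ 1 / 3 * Real.exp (-(2 * d₁ Z)) := fun Z => by simpa [d₁] using hw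
  have h := exp_sum_locE_eq_Z (@Eq Unit) (w := w) (reach := cubes₁) (d := d₁) (A := 1 / 3) (R := 2) (κ₀ := 0)
    (K₀ := 1) (c₁ := 1) (τ := 1) (s := 0) (b := 0) (ν := 1) hloc₁ (fun Z => by rw [one_mul]) (fun _ => le_rfl)
    (by norm_num) (by norm_num) (by norm_num) le_rfl le_rfl hw' h126₁ hvol₁ (by norm_num)
    (by simpa only [one_mul, mul_one] using hsmall₁)
  rw [h, Z₁_eq]

/-- On the one-cube datum the dressed small-field output at the one cube DETERMINES the activity (for activities of size `≤ 1/3`): `E[w]({()}) = E[w′]({()}) →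
w () = w′ ()` (`E(∅)` sees no activity, by `locE_congr`). [folklore] (W23's `locE₁_live` pattern) -/
theorem eq_of_locE_eq_oneCube {w w' : Unit → ℂ} (hw : ‖w ()‖ ≤ 1 / 3) (hw' : ‖w' ()‖ ≤ 1 / 3)
    (heq : locE (@Eq Unit) cubes₁ w {()} = locE (@Eq Unit) cubes₁ w' {()}) : w () = w' () := by
  have hall : ∀ X : Finset Unit, locE (@Eq Unit) cubes₁ w X = locE (@Eq Unit) cubes₁ w' X := by
    intro X
    by_cases hX : () ∈ X
    · have hXu : X = {()} := by ext u; obtain ⟨⟩ := u; simpa using hX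
      rw [hXu]; exact heq
    · have hXe : X = ∅ := by ext u; obtain ⟨⟩ := u; simpa using hX
      have hv : ∀ v : Unit → ℂ, locE (@Eq Unit) cubes₁ v ∅ = locE (@Eq Unit) cubes₁ (fun _ => 0) ∅ := fun v =>
        locE_congr (@Eq Unit) fun Z hZ => absurd (hZ (by simp [cubes₁])) (Finset.notMem_empty ())
      rw [hXe, hv w, hv w']
  have h1 := exp_sum_locE_oneCube hw
  rw [Finset.sum_congr rfl fun X _ => hall X, exp_sum_locE_oneCube hw'] at h1
  exact (add_right_injective (1 : ℂ) h1).symm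

/-- **GENUINE — §3 BOUNDS A NON-ZERO QUANTITY**: with real data as in `actG_live`, the located prefactor `pG α₄` (`α₄ < 1`) and the contour parameter `τ =
α₄/(ε₁ + μ₁b₀)` of §3, the dressed small-field output at the one cube MOVES between the sources `0` and `μ₀` (`0 < μ₀ < μ₁`; tables inside the dressed radius:
`τ(q₀ + μ₁·o₁) < 1` with `q₀ + μ₀o₁ ≤ q₀ + μ₁o₁`). [folklore] -/
theorem locE_live_G {α q₀ v₀ o₁ o₂ ε₁ b₀ μ₀ μ₁ : ℝ} (hα0 : 0 < α) (hα1 : α < 1) (h0 : 0 < μ₀) (h01 : μ₀ < μ₁)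
    (ho₁ : 0 ≤ o₁) (ho₂ : 0 ≤ o₂) (hO : 0 < o₁ + o₂)
    (hV₀ : ‖((q₀ : ℂ), (v₀ : ℂ))‖ ≤ ε₁) (hOb : ‖((o₁ : ℂ), (o₂ : ℂ))‖ ≤ b₀) (hb₀ : 0 < b₀) :
    locE (@Eq Unit) cubes₁ (actG (pG α) (α / (ε₁ + μ₁ * b₀)) ((q₀ : ℂ), (v₀ : ℂ)) ((o₁ : ℂ), (o₂ : ℂ)) μ₀) {()} ≠
      locE (@Eq Unit) cubes₁ (actG (pG α) (α / (ε₁ + μ₁ * b₀)) ((q₀ : ℂ), (v₀ : ℂ)) ((o₁ : ℂ), (o₂ : ℂ)) 0) {()} := by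
  have hε₁ : 0 ≤ ε₁ := (norm_nonneg _).trans hV₀
  have hR : 0 < ε₁ + μ₁ * b₀ := by nlinarith
  have hτ : 0 < α / (ε₁ + μ₁ * b₀) := div_pos hα0 hR
  have hlt : α / (ε₁ + μ₁ * b₀) * (ε₁ + μ₁ * b₀) < 1 := by rw [div_mul_cancel₀ α hR.ne']; exact hα1
  have hp : 0 < pG α := by unfold pG; have := Real.sqrt_pos.2 (show 0 < 1 - α by linarith); positivity
  -- the two tables are inside the dressed radius, so the closed forms of §4 apply
  have hq₀ : q₀ ≤ ε₁ := by
    have := (norm_fst_le ((q₀ : ℂ), (v₀ : ℂ))).trans hV₀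
    rw [Complex.norm_real, Real.norm_eq_abs] at this; exact (le_abs_self q₀).trans this
  have ho₁b : o₁ ≤ b₀ := by
    have := (norm_fst_le ((o₁ : ℂ), (o₂ : ℂ))).trans hOb
    rw [Complex.norm_real, Real.norm_eq_abs] at this; exact (le_abs_self o₁).trans this
  have h1 : α / (ε₁ + μ₁ * b₀) * (q₀ + μ₀ * o₁) < 1 := by
    refine lt_of_le_of_lt (mul_le_mul_of_nonneg_left ?_ hτ.le) hlt
    nlinarith [mul_le_mul h01.le ho₁b ho₁ (h0.le.trans h01.le)]
  intro heq
  have hs : ∀ s : ℂ, ‖s‖ < μ₁ → ‖actG (pG α) (α / (ε₁ + μ₁ * b₀)) ((q₀ : ℂ), (v₀ : ℂ)) ((o₁ : ℂ), (o₂ : ℂ)) s ()‖ ≤ 1 / 3 := by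
    intro s hs; have h := term_norm_le ((pG α : ℝ) : ℂ) hτ.le hV₀ hOb hb₀ hlt (mem_ball_zero_iff.2 hs)
    rwa [div_mul_cancel₀ α hR.ne', norm_pG, pG_majorant hα1] at h
  have hμ₀ : ‖(μ₀ : ℂ)‖ < μ₁ := by rw [Complex.norm_real, Real.norm_of_nonneg h0.le]; exact h01
  have h00 : ‖(0 : ℂ)‖ < μ₁ := by rw [norm_zero]; exact h0.trans h01
  exact actG_live hp hτ h0 ho₁ ho₂ hO h1 (eq_of_locE_eq_oneCube (hs _ hμ₀) (hs _ h00) heq)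

end Summit.QuantumFields.BalabanUV.T4Continuum.NE1p.DressedSmallFieldShapeWitness

end
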